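import Summits.RiemannHypothesis.RiemannHypothesis.Theorems.TiltedLandingLaw421R3RateIsolationSign
import Summits.RiemannHypothesis.RiemannHypothesis.Theorems.TiltedLandingLaw421R3RateUncoveredSign
import Summits.RiemannHypothesis.RiemannHypothesis.Theorems.TiltedLandingLaw421R3TouchedDissipation

/-! # TiltedLandingLaw421R3PairSign — «Im K_w ≤ −1/(2 Im w) + pairPull» at BOTH zeros of an atomic pair (K-2 step S7+S8) — W-08 C1 (rh-idea-5 g35)

SUPPORT module for crux `TiltedLandingLaw421R` ⟨stmt-RiemannHypothesis-33346⟩, route EarlyAppointments (`--supports … --as helper` only; no stub, no crux,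
no law).  Three tree imports: #1180 `…R3RateIsolationSign` (`RhW08.NewtonMate.*`, and through it `RhW08.NestedSign.exists_cofactor` /
`im_mul_im_logDeriv_nonpos`), #1176 `…R3RateUncoveredSign` (`pairPull`, `im_pairField`), #1178 `…R3TouchedDissipation` (`AtomicPair`).
CONTENT = the TWO-PAIR version of #1180's one-pair chain `im_newtonK_le_of_lateral_isolation`, i.e. sockets S7 (pull split) + S8 (foreign sign) of the
K-2 compose map `pub/ideators/rh-idea-5/g35/k2/K2Compose-MAP-W08-C1-rh-idea-5-g35.md`:
§1 `exists_pair_cofactor` — `F` real entire of order `< 2` with two distinct upper zeros `v`, `z` factors as `F = (·−v)(·−v̄)(·−z)(·−z̄)·g` with `g` real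
entire of order `< 2` (`exists_cofactor` twice); simplicity of `v` (`F′ v ≠ 0`) ⇒ `g v ≠ 0` (`cofactor_ne_zero_of_simple`).
§2 ★★ `im_newtonK_le_pairPull` — `F = f⁽ʲ⁾`, `v ≠ z` upper zeros, BOTH SIMPLE, and every OTHER upper zero `u` of `F` disc-separated from `v`
(`Im v + Im u < |Re v − Re u|`) ⇒ **`Im (newtonK f j v) ≤ −1/(2·Im v) + pairPull v z`**: the mate term (`RhW08.NewtonMate.im_newtonK_mate`), the partner
pair's pull (`logDeriv_mul_at` ×2 + `RhW08.UncoveredSign.im_pairField`), and the FOREIGN cofactor's field, which points level-or-down at `v` by the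
value-form JENSEN SIGN `RhW08.NestedSign.im_mul_im_logDeriv_nonpos` — every zero `a` of `g` leaves `v` strictly outside its Jensen disc: real zeros
trivially, upper ones by the separation, lower ones by Schwarz reflection (`Literature.Analysis.Complex.apply_conj_eq_conj`).  Simplicity of `z` is
NECESSARY as typed (a double `z` puts a copy of `z` into `g`, whose pull on `v` has no sign unless `v` is uncovered by `z`).  Frame form over
`EngineHyps5 2` and ★★ `im_newtonK_le_of_atomicPair`: under `RhW08.TouchedDissipation.AtomicPair f j v z` BOTH inequalities, at `v` and at `z`.
§3 the LEADING TERM in `pairPull` currency (lens-2's `Lens2_LeadingDissipation` cross identity, re-proved over the tree's `pairPull` so that no crux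
workfile is imported): `pairPull_eq` (normSq expanded), ★ `leading_ge_three_of_touch`: `|Re v − Re z| ≤ Im v + Im z` ⇒
`3 ≤ (1 − 2·Im v·pairPull v z) + (1 − 2·Im z·pairPull z v)`, and `two_le_leading` (any two upper points).
What it is NOT: not K-2 (`PerturbativeDropLightQ`: needs the located children, K-2a, and the weight/constant bookkeeping — map §3 N1–N3), not RUNG-P, not C′.
Nothing here bears on the truth of RH; RH is NOT proved; K-2 / RUNG-P / ★A / 33346 / 33347 OPEN; checked ≠ landed ≠ proved. -/

namespace RhW08.PairSign

open Complex
open scoped ComplexConjugate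
open Summit.RiemannHypothesis.RiemannHypothesis.Theorems.Splittings.JensenWindow (RealEntireLt2)
open RhW08.AntiEscapeSplit7 (newtonK)
open RhW08.UncoveredSign (pairPull im_pairField)
open RhW08.TouchedDissipation (AtomicPair)

/-! ## §1 The cofactor of a pair -/

/-- separation ⇒ outside the Jensen disc: `|Im a| < |Re v − Re a|` ⇒ `|Im a| < ‖v − Re a‖`. -/
theorem abs_im_lt_norm_of_sep {v a : ℂ} (h : |a.im| < |v.re - a.re|) : |a.im| < ‖v - (a.re : ℂ)‖ := by
  refine h.trans_le ?_
  have h1 := abs_re_le_norm (v - (a.re : ℂ))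
  simpa using h1

/-- a real zero never covers an upper point: `Im a = 0`, `0 < Im v` ⇒ `|Im a| < ‖v − Re a‖`. -/
theorem abs_im_lt_norm_of_real {v a : ℂ} (hv : 0 < v.im) (ha : a.im = 0) : |a.im| < ‖v - (a.re : ℂ)‖ := by
  rw [ha, abs_zero]
  have h1 := abs_im_le_norm (v - (a.re : ℂ))
  have h2 : (v - (a.re : ℂ)).im = v.im := by simp
  rw [h2, abs_of_pos hv] at h1
  exact hv.trans_le h1

/-- `(u − v)(u − v̄) ≠ 0` for an upper `u ≠ v` (`v̄` is not upper). -/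
theorem pair_ne_zero {u v : ℂ} (hu : 0 < u.im) (hv : 0 < v.im) (huv : u ≠ v) : (u - v) * (u - conj v) ≠ 0 := by
  refine mul_ne_zero (sub_ne_zero.mpr huv) (sub_ne_zero.mpr fun e => ?_)
  have h1 : u.im = -v.im := by rw [e, conj_im]
  linarith

/-- ★ §1 THE COFACTOR OF A PAIR: `F` real entire of order `< 2`, `v ≠ z` upper zeros ⇒ `F = (·−v)(·−v̄)(·−z)(·−z̄)·g` with `g` entire of order `< 2`,
real on `ℝ` (`RhW08.NestedSign.exists_cofactor` twice; `RhW08.IsolatedTilt.pairQ_eq_mul`). -/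
theorem exists_pair_cofactor {F : ℂ → ℂ} (hF : RealEntireLt2 F) {v z : ℂ} (hFv : F v = 0) (hFz : F z = 0)
    (hv : 0 < v.im) (hz : 0 < z.im) (hvz : v ≠ z) :
    ∃ g : ℂ → ℂ, Differentiable ℂ g ∧ (∃ ρ C : ℝ, 0 ≤ ρ ∧ ρ < 2 ∧ ∀ u, ‖g u‖ ≤ C * Real.exp (‖u‖ ^ ρ)) ∧ (∀ x : ℝ, (g x).im = 0) ∧
      ∀ u : ℂ, F u = (u - v) * ((u - conj v) * ((u - z) * ((u - conj z) * g u))) := by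
  obtain ⟨h, hd, hgr, hreal, hfac⟩ := RhW08.NestedSign.exists_cofactor hF hFv hv.ne'
  have ev1 : ((v.re : ℂ) + (v.im : ℂ) * I) = v := Complex.re_add_im v
  have ev2 : ((v.re : ℂ) - (v.im : ℂ) * I) = conj v := by apply Complex.ext <;> simp
  have hfac' : ∀ u : ℂ, F u = (u - v) * (u - conj v) * h u := by
    intro u
    rw [hfac u, RhW08.IsolatedTilt.pairQ_eq_mul, ev1, ev2]
  have hhz : h z = 0 := by
    have h1 := hfac' z
    rw [hFz] at h1
    rcases mul_eq_zero.mp h1.symm with h2 | h2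
    · exact absurd h2 (pair_ne_zero hz hv hvz.symm)
    · exact h2
  have hH : RealEntireLt2 h := ⟨hd, hgr, hreal⟩
  obtain ⟨g, gd, ggr, greal, gfac⟩ := RhW08.NestedSign.exists_cofactor hH hhz hz.ne'
  have ez1 : ((z.re : ℂ) + (z.im : ℂ) * I) = z := Complex.re_add_im z
  have ez2 : ((z.re : ℂ) - (z.im : ℂ) * I) = conj z := by apply Complex.ext <;> simp
  refine ⟨g, gd, ggr, greal, fun u => ?_⟩
  rw [hfac' u, gfac u, RhW08.IsolatedTilt.pairQ_eq_mul, ez1, ez2]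
  ring

/-- §1 simplicity ⇒ the cofactor does not vanish at `v`: `F = (·−v)·m`, `m` differentiable at `v`, `F′ v ≠ 0` ⇒ `m v ≠ 0` (`F′ v = m v`,
`RhW08.NewtonMate.dslope_linear_mul`). -/
theorem cofactor_ne_zero_of_simple {F m : ℂ → ℂ} {v : ℂ} (hm : DifferentiableAt ℂ m v) (hfac : ∀ u : ℂ, F u = (u - v) * m u)
    (hsimple : deriv F v ≠ 0) : m v ≠ 0 := by
  have e : F = fun u => (u - v) * m u := funext hfac
  have hderiv : deriv F v = m v := by
    rw [e, ← dslope_same, RhW08.NewtonMate.dslope_linear_mul hm]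
  rwa [hderiv] at hsimple

/-! ## §2 The pair sign -/

/-- the partner pair's logarithmic derivative at `v`: for `G = (·−z)·((·−z̄)·g)` with `g` differentiable at `v`, `G v ≠ 0`,
`G′(v)/G(v) = (v − z)⁻¹ + (v − z̄)⁻¹ + g′(v)/g(v)`. -/
theorem logDeriv_pair_mul {g : ℂ → ℂ} {v z : ℂ} (hg : DifferentiableAt ℂ g v) (hvz : v - z ≠ 0) (hvzb : v - conj z ≠ 0) (hg0 : g v ≠ 0) :
    deriv (fun u => (u - z) * ((u - conj z) * g u)) v / ((v - z) * ((v - conj z) * g v)) =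
      (v - z)⁻¹ + (v - conj z)⁻¹ + deriv g v / g v := by
  have hu1 : DifferentiableAt ℂ (fun u : ℂ => u - z) v := differentiableAt_id.sub (differentiableAt_const _)
  have hu2 : DifferentiableAt ℂ (fun u : ℂ => u - conj z) v := differentiableAt_id.sub (differentiableAt_const _)
  have hG1 : DifferentiableAt ℂ (fun u : ℂ => (u - conj z) * g u) v := hu2.mul hg
  have hG10 : (v - conj z) * g v ≠ 0 := mul_ne_zero hvzb hg0
  have h1 := RhW08.NewtonMate.logDeriv_mul_at hu1 hG1 hvz hG10
  have h2 := RhW08.NewtonMate.logDeriv_mul_at hu2 hg hvzb hg0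
  have d1 : deriv (fun u : ℂ => u - z) v = 1 := by
    rw [deriv_sub_const, deriv_id'']
  have d2 : deriv (fun u : ℂ => u - conj z) v = 1 := by
    rw [deriv_sub_const, deriv_id'']
  simp only [d1, d2, one_div] at h1 h2
  rw [h1, h2, add_assoc]

/-- ★★ §2 **THE PAIR SIGN AT `v`** (class form).  `F = f⁽ʲ⁾` real entire of order `< 2`; `v ≠ z` upper zeros of `F`, BOTH SIMPLE; every OTHER upper zero
`u` of `F` disc-separated from `v` (`Im v + Im u < |Re v − Re u|`).  THEN `Im (newtonK f j v) ≤ −1/(2·Im v) + pairPull v z`: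
mate term `−1/(2 Im v)`, partner pull `pairPull v z`, foreign cofactor field level-or-down (Jensen sign, value form). -/
theorem im_newtonK_le_pairPull_of_class {f : ℂ → ℂ} {j : ℕ} (hF : RealEntireLt2 (iteratedDeriv j f)) {v z : ℂ}
    (hFv : iteratedDeriv j f v = 0) (hFz : iteratedDeriv j f z = 0) (hv : 0 < v.im) (hz : 0 < z.im) (hvz : v ≠ z)
    (hsv : deriv (iteratedDeriv j f) v ≠ 0) (hsz : deriv (iteratedDeriv j f) z ≠ 0)
    (hsep : ∀ u : ℂ, iteratedDeriv j f u = 0 → 0 < u.im → u ≠ v → u ≠ z → v.im + u.im < |v.re - u.re|) :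
    (newtonK f j v).im ≤ -(1 / (2 * v.im)) + pairPull v z := by
  obtain ⟨g, gd, ⟨ρ, C, hρ0, hρ, hgr⟩, greal, hfac⟩ := exists_pair_cofactor hF hFv hFz hv hz hvz
  have hvz' : v - z ≠ 0 := sub_ne_zero.mpr hvz
  have hvzb : v - conj z ≠ 0 := by
    refine sub_ne_zero.mpr fun e => ?_
    have h1 : v.im = -z.im := by rw [e, conj_im]
    linarith
  have hzvb : z - conj v ≠ 0 := by
    refine sub_ne_zero.mpr fun e => ?_
    have h1 : z.im = -v.im := by rw [e, conj_im]
    linarith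
  -- simplicity ⇒ `g v ≠ 0`, `g z ≠ 0`; reflection ⇒ `g v̄ ≠ 0`, `g z̄ ≠ 0`
  have hmv : DifferentiableAt ℂ (fun u : ℂ => (u - conj v) * ((u - z) * ((u - conj z) * g u))) v := by fun_prop
  have hgv : g v ≠ 0 := by
    have h1 := cofactor_ne_zero_of_simple hmv hfac hsv
    intro h0
    apply h1
    simp [h0]
  have hfacz : ∀ u : ℂ, iteratedDeriv j f u = (u - z) * ((u - conj z) * ((u - v) * ((u - conj v) * g u))) := fun u => by
    rw [hfac u]; ring
  have hmz : DifferentiableAt ℂ (fun u : ℂ => (u - conj z) * ((u - v) * ((u - conj v) * g u))) z := by fun_prop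
  have hgz : g z ≠ 0 := by
    have h1 := cofactor_ne_zero_of_simple hmz hfacz hsz
    intro h0
    apply h1
    simp [h0]
  have hgvb : g (conj v) ≠ 0 := by
    rw [Literature.Analysis.Complex.apply_conj_eq_conj gd greal v, map_ne_zero]; exact hgv
  have hgzb : g (conj z) ≠ 0 := by
    rw [Literature.Analysis.Complex.apply_conj_eq_conj gd greal z, map_ne_zero]; exact hgz
  -- the mate form with partner-pair cofactor `G`
  set G : ℂ → ℂ := fun u => (u - z) * ((u - conj z) * g u) with hGdef
  have hGd : DifferentiableAt ℂ G v := by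
    show DifferentiableAt ℂ (fun u => (u - z) * ((u - conj z) * g u)) v
    fun_prop
  have hGv : G v ≠ 0 := mul_ne_zero hvz' (mul_ne_zero hvzb hgv)
  have hFm : ∀ u : ℂ, iteratedDeriv j f u = (u - v) * ((u - conj v) * G u) := fun u => hfac u
  have hK : (newtonK f j v).im = -1 / (2 * v.im) + (deriv G v / G v).im :=
    RhW08.NewtonMate.im_newtonK_mate hv.ne' hGd hGv hFm
  have hsplit : deriv G v / G v = (v - z)⁻¹ + (v - conj z)⁻¹ + deriv g v / g v :=
    logDeriv_pair_mul gd.differentiableAt hvz' hvzb hgv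
  -- every zero of the foreign cofactor leaves `v` strictly outside its Jensen disc
  have hout : ∀ a : ℂ, g a = 0 → |a.im| < ‖v - (a.re : ℂ)‖ := by
    intro a ha
    have hFa : ∀ b : ℂ, g b = 0 → iteratedDeriv j f b = 0 := fun b hb => by rw [hfac b, hb]; ring
    rcases lt_trichotomy a.im 0 with hlt | heq | hgt
    · -- lower zero: reflect
      have hab : g (conj a) = 0 := by
        rw [Literature.Analysis.Complex.apply_conj_eq_conj gd greal a, ha, map_zero]
      have hpos : 0 < (conj a).im := by rw [conj_im]; linarith
      have hne_v : conj a ≠ v := fun e => hgv (e ▸ hab)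
      have hne_z : conj a ≠ z := fun e => hgz (e ▸ hab)
      have h1 := hsep (conj a) (hFa _ hab) hpos hne_v hne_z
      rw [conj_re, conj_im] at h1
      refine abs_im_lt_norm_of_sep ?_
      rw [abs_of_neg hlt]
      linarith [le_abs_self (v.re - a.re)]
    · exact abs_im_lt_norm_of_real hv heq
    · have hne_v : a ≠ v := fun e => hgv (e ▸ ha)
      have hne_z : a ≠ z := fun e => hgz (e ▸ ha)
      have h1 := hsep a (hFa a ha) hgt hne_v hne_z
      refine abs_im_lt_norm_of_sep ?_
      rw [abs_of_pos hgt]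
      linarith
  -- JENSEN SIGN (value form) for the foreign cofactor at `v`
  have hsign := RhW08.NestedSign.im_mul_im_logDeriv_nonpos gd hρ0 hρ hgr greal hgv hout
  have hsign' : (deriv g v / g v).im ≤ 0 :=
    le_of_not_gt fun hc => absurd hsign (not_le.mpr (mul_pos hv hc))
  rw [hK, hsplit, add_im, im_pairField]
  have e : (-1 : ℝ) / (2 * v.im) = -(1 / (2 * v.im)) := by ring
  rw [e]
  linarith

open RhIdea6.G17.W07C7 RhIdea6.G17.W07C7.Rev6 RhIdea6.G18.W07C8.Law421BirthS RhIdea6.G19.W07C11.Seam RhIdea6.G20.W07C12.Frac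
  RhIdea6.G20.W07C12.StColP RhW07.C12.FieldSplit RhW08.Round1 RhW08.StSwap RhW08.Round2 RhW08.QuadW RhW08.SealSwapQ in
/-- ★★ §2 **THE PAIR SIGN AT `v`, FRAME FORM**: on an `EngineHyps5 2` frame (class heredity `RhW08.Column.realEntireLt2_of_hyps` +
`RhW08.WindowLoss.realEntireLt2_iteratedDeriv`), the hypotheses of `im_newtonK_le_pairPull_of_class` give `Im (newtonK f j v) ≤ −1/(2·Im v) + pairPull v z`. -/
theorem im_newtonK_le_pairPull {η : ℝ} {f : ℂ → ℂ} {x₀ s hmax R Hs : ℝ} {B : ℕ} (hE : EngineHyps5 2 η f x₀ s hmax R Hs B)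
    {j : ℕ} {v z : ℂ} (hFv : iteratedDeriv j f v = 0) (hFz : iteratedDeriv j f z = 0) (hv : 0 < v.im) (hz : 0 < z.im) (hvz : v ≠ z)
    (hsv : deriv (iteratedDeriv j f) v ≠ 0) (hsz : deriv (iteratedDeriv j f) z ≠ 0)
    (hsep : ∀ u : ℂ, iteratedDeriv j f u = 0 → 0 < u.im → u ≠ v → u ≠ z → v.im + u.im < |v.re - u.re|) :
    (newtonK f j v).im ≤ -(1 / (2 * v.im)) + pairPull v z :=
  im_newtonK_le_pairPull_of_class (RhW08.WindowLoss.realEntireLt2_iteratedDeriv (RhW08.Column.realEntireLt2_of_hyps hE) j)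
    hFv hFz hv hz hvz hsv hsz hsep

open RhIdea6.G17.W07C7 RhIdea6.G17.W07C7.Rev6 RhIdea6.G18.W07C8.Law421BirthS RhIdea6.G19.W07C11.Seam RhIdea6.G20.W07C12.Frac
  RhIdea6.G20.W07C12.StColP RhW07.C12.FieldSplit RhW08.Round1 RhW08.StSwap RhW08.Round2 RhW08.QuadW RhW08.SealSwapQ in
/-- ★★ §2 **THE PAIR SIGN UNDER `AtomicPair`** (the K-2 binder, by name): both zeros of an atomic pair of SIMPLE upper zeros `v ≠ z` of `f⁽ʲ⁾` on an
`EngineHyps5 2` frame have their Newton field pointing at least as far down as mate + partner: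
`Im K_v ≤ −1/(2·Im v) + pairPull v z` and `Im K_z ≤ −1/(2·Im z) + pairPull z v`. -/
theorem im_newtonK_le_of_atomicPair {η : ℝ} {f : ℂ → ℂ} {x₀ s hmax R Hs : ℝ} {B : ℕ} (hE : EngineHyps5 2 η f x₀ s hmax R Hs B)
    {j : ℕ} {v z : ℂ} (hFv : iteratedDeriv j f v = 0) (hFz : iteratedDeriv j f z = 0) (hv : 0 < v.im) (hz : 0 < z.im) (hvz : v ≠ z)
    (hsv : deriv (iteratedDeriv j f) v ≠ 0) (hsz : deriv (iteratedDeriv j f) z ≠ 0) (hat : AtomicPair f j v z) :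
    (newtonK f j v).im ≤ -(1 / (2 * v.im)) + pairPull v z ∧ (newtonK f j z).im ≤ -(1 / (2 * z.im)) + pairPull z v :=
  ⟨im_newtonK_le_pairPull hE hFv hFz hv hz hvz hsv hsz fun u hu hpos huv huz => (hat u hu hpos huv huz).1,
    im_newtonK_le_pairPull hE hFz hFv hz hv hvz.symm hsz hsv fun u hu hpos huz huv => (hat u hu hpos huv huz).2⟩

/-! ## §3 The leading term in `pairPull` currency -/

/-- the pull with `normSq` expanded: `pairPull v z = (Im z − Im v)/((Re v − Re z)² + (Im v − Im z)²) − (Im z + Im v)/((Re v − Re z)² + (Im v + Im z)²)`. -/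
theorem pairPull_eq (v z : ℂ) :
    pairPull v z = (z.im - v.im) / ((v.re - z.re) ^ 2 + (v.im - z.im) ^ 2) - (z.im + v.im) / ((v.re - z.re) ^ 2 + (v.im + z.im) ^ 2) := by
  simp only [pairPull, Complex.normSq_apply, sub_re, sub_im, conj_re, conj_im]
  ring_nf

/-- (real algebra, lens-2's CROSS IDENTITY `Lens2_LeadingDissipation.cross_identity` re-proved in coordinates)
`a·P(v,z) + b·P(z,v) = −(a−b)²/N₁ − (a+b)²/N₂`, `N₁ = Δ² + (a−b)²`, `N₂ = Δ² + (a+b)²`. -/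
theorem cross_identity_real (a b Δ : ℝ) :
    a * ((b - a) / (Δ ^ 2 + (a - b) ^ 2) - (b + a) / (Δ ^ 2 + (a + b) ^ 2)) +
      b * ((a - b) / (Δ ^ 2 + (b - a) ^ 2) - (a + b) / (Δ ^ 2 + (b + a) ^ 2)) =
      -((a - b) ^ 2 / (Δ ^ 2 + (a - b) ^ 2)) - (a + b) ^ 2 / (Δ ^ 2 + (a + b) ^ 2) := by
  have h1 : (b - a) ^ 2 = (a - b) ^ 2 := by ring
  rw [h1, show b + a = a + b by ring]
  ring

/-- (real algebra, lens-2's `leading_ge_three_of_touch` in coordinates) touching `|Δ| ≤ a + b`, `0 < a + b` ⇒ the leading sum is `≥ 3`. -/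
theorem leading_ge_three_real {a b Δ : ℝ} (hab : 0 < a + b) (ht : |Δ| ≤ a + b) :
    3 ≤ (1 - 2 * a * ((b - a) / (Δ ^ 2 + (a - b) ^ 2) - (b + a) / (Δ ^ 2 + (a + b) ^ 2))) +
      (1 - 2 * b * ((a - b) / (Δ ^ 2 + (b - a) ^ 2) - (a + b) / (Δ ^ 2 + (b + a) ^ 2))) := by
  have key := cross_identity_real a b Δ
  have hN2 : 0 < Δ ^ 2 + (a + b) ^ 2 := by positivity
  have hΔ : Δ ^ 2 ≤ (a + b) ^ 2 := by
    have h := sq_le_sq' (by linarith [neg_abs_le Δ, abs_nonneg Δ]) ht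
    simpa using h
  have h2 : 1 / 2 ≤ (a + b) ^ 2 / (Δ ^ 2 + (a + b) ^ 2) := by
    rw [div_le_div_iff₀ (by norm_num) hN2]; nlinarith
  have h1 : 0 ≤ (a - b) ^ 2 / (Δ ^ 2 + (a - b) ^ 2) := div_nonneg (sq_nonneg _) (by positivity)
  nlinarith [key, h1, h2]

/-- ★ §3 **LEADING TERM ≥ 3 FOR A TOUCHING PAIR** (`pairPull` currency): `|Re v − Re z| ≤ Im v + Im z`, `0 < Im v + Im z` ⇒
`3 ≤ (1 − 2·Im v·pairPull v z) + (1 − 2·Im z·pairPull z v)`. -/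
theorem leading_ge_three_of_touch {v z : ℂ} (hab : 0 < v.im + z.im) (ht : |v.re - z.re| ≤ v.im + z.im) :
    3 ≤ (1 - 2 * v.im * pairPull v z) + (1 - 2 * z.im * pairPull z v) := by
  rw [pairPull_eq v z, pairPull_eq z v]
  have e1 : (z.re - v.re) ^ 2 = (v.re - z.re) ^ 2 := by ring
  rw [e1]
  exact leading_ge_three_real hab ht

/-- §3 any two upper points: the leading sum is `≥ 2` (lens-2's `leading_ge_two`; the cross term is `≤ 0`). -/
theorem two_le_leading (v z : ℂ) : 2 ≤ (1 - 2 * v.im * pairPull v z) + (1 - 2 * z.im * pairPull z v) := by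
  rw [pairPull_eq v z, pairPull_eq z v]
  have e1 : (z.re - v.re) ^ 2 = (v.re - z.re) ^ 2 := by ring
  rw [e1]
  have key := cross_identity_real v.im z.im (v.re - z.re)
  have h1 : 0 ≤ (v.im - z.im) ^ 2 / ((v.re - z.re) ^ 2 + (v.im - z.im) ^ 2) := div_nonneg (sq_nonneg _) (by positivity)
  have h2 : 0 ≤ (v.im + z.im) ^ 2 / ((v.re - z.re) ^ 2 + (v.im + z.im) ^ 2) := div_nonneg (sq_nonneg _) (by positivity)
  nlinarith [key, h1, h2]

end RhW08.PairSign
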